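import Mathlib
import Literature.Computability.AlgebraicComplexity.StandardFamilies
import Literature.Computability.AlgebraicComplexity.StandardFamiliesProofs
import Summits.ValiantsHypothesis.ValiantsHypothesis.Theorems.SummationBitsHomogeneousRung

/-!
# Crux `WordLengthQP` (stmt-ValiantsHypothesis-6623), line `Sketch` (eps-order-ladder) —
stub `stub_sigmaPiSigma_lowDegree_perm`

Nisan–Wigderson's partial-derivative bound for depth-three expressions of the permanent with
product fan-in `≤ n`: if `per_n = Σ_{i ∈ s} c_i · Π (Ls i)` where every factor is affine (total
degree `≤ 1`) and every product has at most `n` factors, then `#s ≥ binom(n, k)` for every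
`k ≤ n`.

The work is the tree theorem `Summit.ValiantsHypothesis.SummationBits.homogeneousRung_proof`
(support item `HomogeneousRung` of route SummationBits: exactly `n` affine factors per summand, no
coefficients, `k = ⌊n/2⌋`, `#summands ≥ binom(n, ⌊n/2⌋)`).  We reduce to it by padding every
product with factors `1` up to length `n` (`List.getD _ j 1`), absorbing the coefficient `c_i` into
the factor of index `0` (which stays affine), reindexing the sum over `s` by `Fin #s`
(`Finset.equivFin`), and finishing with `binom(n, k) ≤ binom(n, ⌊n/2⌋)` (`Nat.choose_le_middle`).
The degenerate case `n = 0` (where `HomogeneousRung` does not apply) is `1 ≤ #s`, which holds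
because `per_0 = 1 ≠ 0` is not an empty sum.

## References

* [NisanWigderson1996] N. Nisan, A. Wigderson, *Lower bounds on arithmetic circuits via partial
  derivatives*, Comput. Complexity 6 (1996), Thm. 3.2.
* [LandsbergGCT2017] J. M. Landsberg, *Geometry and Complexity Theory*, CUP 2017, Prop. 7.2.2.1.
-/

-- `Summit.ValiantsHypothesis.ValiantsHypothesis.…` is the tree's mandated single-conjunct layout
-- (Sub = Summit), so the duplicated namespace component is intended.
set_option linter.dupNamespace false

noncomputable section

open MvPolynomial

namespace Summit.ValiantsHypothesis.ValiantsHypothesis.Cruxes.WordLengthQP.EpsOrderLadder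

open Literature.Computability.AlgebraicComplexity

/-- Padding a list with the default `1` beyond its length does not change the product: if
`L.length ≤ n` then `∏_{j < n} L.getD j 1 = L.prod`. [folklore] -/
theorem sigmaPiSigmaPerm_prod_getD {M : Type*} [CommMonoid M] (L : List M) (n : ℕ)
    (hL : L.length ≤ n) : ∏ j : Fin n, L.getD j 1 = L.prod := by
  induction L generalizing n with
  | nil => simp
  | cons a L ih =>
    cases n with
    | zero => exact absurd hL (by simp)
    | succ m =>
      rw [Fin.prod_univ_succ, List.prod_cons]
      simp only [Fin.val_zero, Fin.val_succ, List.getD_cons_zero, List.getD_cons_succ]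
      rw [ih m (by simpa using hL)]

/-- If every member of a list of polynomials is affine (total degree `≤ 1`), then so is every
padded entry `L.getD j 1`. [folklore] -/
theorem sigmaPiSigmaPerm_totalDegree_getD_le {σ R : Type*} [CommSemiring R]
    (L : List (MvPolynomial σ R)) (hL : ∀ ℓ ∈ L, ℓ.totalDegree ≤ 1) (j : ℕ) :
    (L.getD j 1).totalDegree ≤ 1 := by
  induction L generalizing j with
  | nil => rw [List.getD_nil, totalDegree_one]; exact Nat.zero_le _
  | cons a L ih =>
    cases j with
    | zero => rw [List.getD_cons_zero]; exact hL a List.mem_cons_self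
    | succ j =>
      rw [List.getD_cons_succ]
      exact ih (fun ℓ hℓ => hL ℓ (List.mem_cons_of_mem a hℓ)) j

/-- Over `Fin (m + 1)`, the product of the factors "`C a` at index `0`, `1` elsewhere" is `C a`.
[folklore] -/
theorem sigmaPiSigmaPerm_prod_ite_val_eq_zero {σ R : Type*} [CommSemiring R] (m : ℕ) (a : R) :
    ∏ j : Fin (m + 1), (if (j : ℕ) = 0 then C a else (1 : MvPolynomial σ R)) = C a := by
  rw [Fin.prod_univ_succ]
  simp

/-- **stub_sigmaPiSigma_lowDegree_perm** (Nisan–Wigderson's bound for depth-3 expressions of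
product fan-in `≤ n`, in particular HOMOGENEOUS `ΣΠΣ`, for the permanent): if `per_n` is a linear
combination of `#s` products of at most `n` affine forms each, then `#s ≥ binom(n, k)` for every
`k ≤ n`.  Reduced to the tree theorem `homogeneousRung_proof` (exactly `n` factors, bound
`binom(n, ⌊n/2⌋)`) by padding with `1`s and absorbing the coefficients, then
`Nat.choose_le_middle`. [cite: NisanWigderson1996, Thm. 3.2] -/
theorem stub_sigmaPiSigma_lowDegree_perm (n : ℕ) {ι : Type} (s : Finset ι) (c : ι → ℂ)
    (Ls : ι → List (MvPolynomial (Fin n × Fin n) ℂ))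
    (hdeg : ∀ i ∈ s, ∀ ℓ ∈ Ls i, ℓ.totalDegree ≤ 1) (hlen : ∀ i ∈ s, (Ls i).length ≤ n)
    (hper : Literature.Computability.AlgebraicComplexity.perPoly (Fin n) ℂ =
      ∑ i ∈ s, MvPolynomial.C (c i) * (Ls i).prod)
    (k : ℕ) (hk : k ≤ n) :
    n.choose k ≤ s.card := by
  classical
  rcases Nat.eq_zero_or_pos n with rfl | hn
  · -- `n = 0`: `k = 0`, `binom(0,0) = 1`, and `s` is nonempty since `per_0 ≠ 0`.
    obtain rfl : k = 0 := Nat.le_zero.mp hk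
    rw [Nat.choose_zero_right]
    have hne : (∑ i ∈ s, MvPolynomial.C (c i) * (Ls i).prod) ≠ 0 := by
      rw [← hper]
      exact perPoly_ne_zero (Fin 0) ℂ
    exact Finset.card_pos.mpr (Finset.nonempty_of_sum_ne_zero hne)
  · -- `1 ≤ n`: write `n = m + 1` and reduce to `HomogeneousRung`.
    obtain ⟨m, rfl⟩ : ∃ m, n = m + 1 := ⟨n - 1, by omega⟩
    refine (Nat.choose_le_middle k (m + 1)).trans ?_
    -- enumerate `s` by `Fin #s`
    set e : Fin s.card ≃ {x // x ∈ s} := s.equivFin.symm with he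
    refine Summit.ValiantsHypothesis.SummationBits.homogeneousRung_proof (m + 1) hn s.card
      (fun i j => (if (j : ℕ) = 0 then MvPolynomial.C (c (e i)) else 1) * (Ls (e i)).getD j 1)
      ?_ ?_
    · -- every padded / rescaled factor is affine
      intro i j
      refine (totalDegree_mul _ _).trans ?_
      have h0 : (if (j : ℕ) = 0 then MvPolynomial.C (c (e i))
          else (1 : MvPolynomial (Fin (m + 1) × Fin (m + 1)) ℂ)).totalDegree = 0 := by
        split_ifs
        · exact totalDegree_C _
        · exact totalDegree_one
      rw [h0, zero_add]
      exact sigmaPiSigmaPerm_totalDegree_getD_le _ (hdeg _ (e i).2) _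
    · -- the padded sum is the given expression, i.e. `per_n`
      rw [hper, ← Finset.sum_coe_sort s, ← Equiv.sum_comp e]
      refine Finset.sum_congr rfl fun i _ => ?_
      rw [Finset.prod_mul_distrib, sigmaPiSigmaPerm_prod_ite_val_eq_zero,
        sigmaPiSigmaPerm_prod_getD _ _ (hlen _ (e i).2)]

end Summit.ValiantsHypothesis.ValiantsHypothesis.Cruxes.WordLengthQP.EpsOrderLadder

end
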